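import Summits.Ventures.PercRepro.GenQPairChoose
import Summits.Ventures.PercRepro.GenQOpenLayersCoreSmall

/-!
# PercRepro — THE `t = 2` WINDOW OF THE `(8, 6)` ROW ON THE CORE, IN THE KERNEL (night-4, gen 3; sheet §49)

The type-`2` balance `0 ≤ Jq M G 6 2` on every rank-`6` flat `G` with at most `12` points of a matroid whose lines
have at most `3` points (every Core matroid), by the same two charging layers as at `(7, 5)`
(`GenQSevenFiveTypeTwo.lean`) with the sharper pair count `nb(B₀ ∪ {x, y}) ≤ C(#(C_x ∪ C_y), 2)`
(`GenQPairChoose.lean`):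

* at `q = 6` a pair charges at least `2/15 − (2/15 − 1/28)·dem` whatever the circuit sizes (`pair_share_six_ge`:
  `u = #(C_x ∪ C_y) ∈ [5, 8]`, `m ≤ 8 − u`, `nb ≤ C(u, 2)`), a singleton at least `(6/5 − (8/7)·dem)/3` (`#C = 3`)
  or `(3/2 − (8/7)·dem)/4`;
* `charge_arith_six`: the `25` cases `k ≤ 6`, `k₃ ≤ k` (tightest `k = k₃ = 4`: `8/105 + 6/28 = 61/210 ≥ 2/7`).

Main statements: `jq_two_nonneg_of_core_six`, `EightSixResidueCore` (the `t = 1` window `g ∈ {8, 9}` and the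
`t = 3, 4, 5` balances — the exact remaining gap of the row `(8, 6)` at level `6`), `openLayersCore_six_of_residue`,
`rls_eight_six_of_residue : OpenLayersCore 5 → EightSixResidueCore → ∀ M, RLS M 8 6`.
-/

namespace PercRepro.GenQ

open Finset ThmH PerFlat SixFour ThmN NightThree

variable {α : Type*} [DecidableEq α] {M : Matroid α} [M.Finite]

/-! ## The two layers at `q = 6` -/

/-- The share from `B₀ ∪ {x}` at `q = 6` with `#C_x = 3`: at least `(6/5 − (8/7)·dem)/3`. -/
theorem single_share_six_of_three (hs : Simple M) {G B₀ : Finset α} (hG : G ⊆ gr M)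
    (hrG : M.eRk (G : Set α) = ((6 : ℕ) : ℕ∞)) (hB : B₀ ∈ basesOf M G 6) {x : α} (hx : x ∈ G) (hxB : x ∉ B₀)
    (hcx : (fc M x B₀).card = 3) :
    (6 / 5 - 8 / 7 * dem M G 2 (insert x B₀)) / 3 ≤ wTwo M G (insert x B₀) 6 / nb M G (insert x B₀) 6 := by
  have h := single_share_ge hs hG hrG hB (by norm_num) hx hxB
  rw [hcx] at h
  norm_num at h
  linarith

/-- The share from `B₀ ∪ {x}` at `q = 6` with `#C_x ≥ 4`: at least `(3/2 − (8/7)·dem)/4`. -/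
theorem single_share_six_of_ge_four (hs : Simple M) {G B₀ : Finset α} (hG : G ⊆ gr M)
    (hrG : M.eRk (G : Set α) = ((6 : ℕ) : ℕ∞)) (hB : B₀ ∈ basesOf M G 6) {x : α} (hx : x ∈ G) (hxB : x ∉ B₀)
    (hcx : 4 ≤ (fc M x B₀).card) :
    (3 / 2 - 8 / 7 * dem M G 2 (insert x B₀)) / 4 ≤ wTwo M G (insert x B₀) 6 / nb M G (insert x B₀) 6 := by
  have h := single_share_ge hs hG hrG hB (by norm_num) hx hxB
  have hc7 : (fc M x B₀).card ≤ 7 := by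
    have := card_fc_le (M := M) x B₀
    rw [(mem_basesOf.1 hB).2.2] at this
    omega
  have hd0 := dem_nonneg (M := M) G (insert x B₀) 2
  rcases (show (fc M x B₀).card = 4 ∨ (fc M x B₀).card = 5 ∨ (fc M x B₀).card = 6 ∨ (fc M x B₀).card = 7 by
    omega) with h4 | h5 | h6 | h7
  · rw [h4] at h
    norm_num at h
    linarith
  · rw [h5] at h
    norm_num at h
    linarith
  · rw [h6] at h
    norm_num at h
    linarith
  · rw [h7] at h
    norm_num at h
    linarith

/-- **Every pair charges at least `2/15 − (2/15 − 1/28)·dem` at `q = 6`** (lines `≤ 3` points): with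
`u = #(C_x ∪ C_y) ∈ [5, 8]`, `m ≤ 8 − u` and `nb ≤ C(u, 2)`. -/
theorem pair_share_six_ge (hs : Simple M) (hline : ∀ L ∈ flatsQ M 2, L.card ≤ 3) {G B₀ : Finset α}
    (hG : G ⊆ gr M) (hrG : M.eRk (G : Set α) = ((6 : ℕ) : ℕ∞)) (hB : B₀ ∈ basesOf M G 6) {x y : α} (hx : x ∈ G)
    (hxB : x ∉ B₀) (hy : y ∈ G) (hyB : y ∉ B₀) (hxy : x ≠ y) :
    2 / 15 - (2 / 15 - 1 / 28) * dem M G 2 (insert x (insert y B₀)) ≤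
      wTwo M G (insert x (insert y B₀)) 6 / nb M G (insert x (insert y B₀)) 6 := by
  set S := insert x (insert y B₀) with hSdef
  obtain ⟨hBG, hr, hc⟩ := mem_basesOf.1 hB
  have hR : S ∈ Rq M G 6 := pair_mem_Rq hrG hB hx hy
  have hxS : x ∉ insert y B₀ := fun h' => by
    rcases Finset.mem_insert.1 h' with h'' | h''
    · exact hxy h''
    · exact hxB h''
  have hcardS : S.card = 8 := by
    rw [hSdef, Finset.card_insert_of_notMem hxS, Finset.card_insert_of_notMem hyB, hc]
  have hw0 : 0 ≤ wTwo M G S 6 := wTwo_nonneg_of_card_ne hs hG (by norm_num) hR (by rw [hcardS]; norm_num)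
  have hnb1 := one_le_nb hR
  have hU := five_le_card_union_fc hs hline hG hrG hB (by norm_num) hx hxB hy hyB hxy
  have hU8 : (fc M x B₀ ∪ fc M y B₀).card ≤ 8 := by
    have : fc M x B₀ ∪ fc M y B₀ ⊆ S := Finset.union_subset
      ((fc_subset_insert x B₀).trans (Finset.insert_subset_insert x (Finset.subset_insert y B₀)))
      ((fc_subset_insert y B₀).trans (Finset.subset_insert x _))
    have := Finset.card_le_card this
    omega
  have hm := mTr_pair_le hG hrG hB hx hxB hy hyB hxy
  have hnb := nb_pair_le_choose hG hrG hB hx hxB hy hyB hxy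
  rw [← hSdef] at hm hnb
  have hnbpos : (0 : ℚ) < nb M G S 6 := by exact_mod_cast (by omega : 0 < nb M G S 6)
  have hdem0 := dem_nonneg (M := M) G S 2
  have hdem1 := dem_le_one (M := M) G S 2
  have hwTwo : wTwo M G S 6 = 6 * (1 / (1 + (mTr M S : ℚ))) - 8 / 7 * dem M G 2 S := by
    unfold wTwo wInf
    push_cast
    ring
  -- `u ∈ {5, 6, 7, 8}`: `m ≤ 8 − u`, `nb ≤ C(u, 2)`
  have branch : ∀ (n m : ℕ) (w : ℚ), 0 < n → nb M G S 6 ≤ n → mTr M S ≤ m →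
      w ≤ 6 * (1 / (1 + (m : ℚ))) - 8 / 7 * dem M G 2 S → w / n ≤ wTwo M G S 6 / nb M G S 6 := by
    intro n m w hn hnb' hm' hw
    have hm'' : (mTr M S : ℚ) ≤ m := by exact_mod_cast hm'
    have hwinf : 1 / (1 + (m : ℚ)) ≤ 1 / (1 + (mTr M S : ℚ)) :=
      one_div_le_one_div_of_le (by positivity) (by linarith)
    have hw' : w ≤ wTwo M G S 6 := by
      rw [hwTwo]
      linarith
    have hn' : (nb M G S 6 : ℚ) ≤ n := by exact_mod_cast hnb'
    calc w / n ≤ wTwo M G S 6 / n := div_le_div_of_nonneg_right hw' (Nat.cast_nonneg n)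
      _ ≤ wTwo M G S 6 / nb M G S 6 := div_le_div_of_nonneg_left hw0 hnbpos hn'
  rcases (show (fc M x B₀ ∪ fc M y B₀).card = 5 ∨ (fc M x B₀ ∪ fc M y B₀).card = 6 ∨
      (fc M x B₀ ∪ fc M y B₀).card = 7 ∨ (fc M x B₀ ∪ fc M y B₀).card = 8 by omega) with h5 | h6 | h7 | h8
  · refine le_trans ?_ (branch 10 3 (3 / 2 - 8 / 7 * dem M G 2 S) (by norm_num)
      (hnb.trans (by rw [h5]; decide)) (by omega) (by norm_num))
    push_cast
    linarith
  · refine le_trans ?_ (branch 15 2 (2 - 8 / 7 * dem M G 2 S) (by norm_num)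
      (hnb.trans (by rw [h6]; decide)) (by omega) (by norm_num))
    push_cast
    linarith
  · refine le_trans ?_ (branch 21 1 (3 - 8 / 7 * dem M G 2 S) (by norm_num)
      (hnb.trans (by rw [h7]; decide)) (by omega) (by norm_num))
    push_cast
    linarith
  · refine le_trans ?_ (branch 28 0 (6 - 8 / 7 * dem M G 2 S) (by norm_num)
      (hnb.trans (by rw [h8]; decide)) (by omega) (by norm_num))
    push_cast
    linarith

/-! ## The charge of a demanding basis is at least `2/7` -/

/-- The arithmetic of the two layers at `q = 6`: `k = #K ∈ [2, 6]`, `k₃ = #K₃ ≤ k`. -/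
theorem charge_arith_six (k k₃ : ℕ) (hk : 2 ≤ k) (hk6 : k ≤ 6) (hk₃ : k₃ ≤ k) (d₁ d₂ : ℚ) (hd₁0 : 0 ≤ d₁)
    (hd₁1 : d₁ ≤ 1) (hd₂0 : 0 ≤ d₂) (hd₂1 : d₂ ≤ 1) (hd₁ : k ≤ 2 → d₁ = 0) (hd₂ : k ≤ 3 → d₂ = 0) :
    2 / 7 ≤ (k₃ : ℚ) * ((6 / 5 - 8 / 7 * d₁) / 3) + ((k - k₃ : ℕ) : ℚ) * ((3 / 2 - 8 / 7 * d₁) / 4) +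
      ((k.choose 2 : ℕ) : ℚ) * (2 / 15 - (2 / 15 - 1 / 28) * d₂) := by
  interval_cases k <;> interval_cases k₃ <;> norm_num [Nat.choose] at hd₁ hd₂ ⊢ <;>
    first | (subst hd₁; subst hd₂; norm_num) | (subst hd₂; linarith) | linarith

/-- **Every basis `B₀` of `G` with `2 ≤ #(G ∖ B₀) ≤ 6` is charged at least `2/7`** at `q = 6`. -/
theorem eightSix_charge_ge (hs : Simple M) (hline : ∀ L ∈ flatsQ M 2, L.card ≤ 3) {G B₀ : Finset α}
    (hG : G ⊆ gr M) (hrG : M.eRk (G : Set α) = ((6 : ℕ) : ℕ∞)) (hB : B₀ ∈ basesOf M G 6)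
    (hk : 2 ≤ (G \ B₀).card) (hk6 : (G \ B₀).card ≤ 6) : 2 / 7 ≤ charge M G 6 B₀ := by
  set K := G \ B₀ with hK
  set D₁ : ℚ := if K.card ≤ 2 then 0 else 1 with hD₁
  set D₂ : ℚ := if K.card ≤ 3 then 0 else 1 with hD₂
  have hdem₁ : ∀ x ∈ K, dem M G 2 (insert x B₀) ≤ D₁ := by
    intro x hxK
    rw [hD₁]
    split_ifs with hk2
    · rw [dem_two_eq_zero_of_card_le_one]
      have : G \ insert x B₀ = K.erase x := by
        ext e
        simp only [Finset.mem_sdiff, Finset.mem_insert, Finset.mem_erase, hK]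
        tauto
      rw [this, Finset.card_erase_of_mem hxK]
      omega
    · exact dem_le_one G (insert x B₀) 2
  have hdem₂ : ∀ P ∈ K.powersetCard 2, dem M G 2 (B₀ ∪ P) ≤ D₂ := by
    intro P hP
    obtain ⟨hPsub, hPc⟩ := Finset.mem_powersetCard.1 hP
    rw [hD₂]
    split_ifs with hk3
    · rw [dem_two_eq_zero_of_card_le_one]
      have : G \ (B₀ ∪ P) = K \ P := by
        ext e
        simp only [Finset.mem_sdiff, Finset.mem_union, hK]
        tauto
      rw [this, Finset.card_sdiff_of_subset hPsub, hPc]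
      omega
    · exact dem_le_one G (B₀ ∪ P) 2
  have h := charge_ge_of_bounds hs hG hrG hB (by norm_num) ((6 / 5 - 8 / 7 * D₁) / 3) ((3 / 2 - 8 / 7 * D₁) / 4)
    (2 / 15 - (2 / 15 - 1 / 28) * D₂) ?_ ?_ ?_
  · have harith := charge_arith_six K.card (K.filter (fun x => (fc M x B₀).card = 3)).card hk hk6
      (Finset.card_le_card (Finset.filter_subset _ _)) D₁ D₂ (by rw [hD₁]; split_ifs <;> norm_num)
      (by rw [hD₁]; split_ifs <;> norm_num) (by rw [hD₂]; split_ifs <;> norm_num)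
      (by rw [hD₂]; split_ifs <;> norm_num) (fun h2 => by rw [hD₁, if_pos h2]) (fun h3 => by rw [hD₂, if_pos h3])
    linarith
  · intro x hx hcx
    have hxG : x ∈ G := (Finset.mem_sdiff.1 hx).1
    have hxB : x ∉ B₀ := (Finset.mem_sdiff.1 hx).2
    refine le_trans ?_ (single_share_six_of_three hs hG hrG hB hxG hxB hcx)
    have := hdem₁ x hx
    rw [div_le_div_iff_of_pos_right (by norm_num)]
    linarith
  · intro x hx hcx
    have hxG : x ∈ G := (Finset.mem_sdiff.1 hx).1
    have hxB : x ∉ B₀ := (Finset.mem_sdiff.1 hx).2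
    have h3 := three_le_card_fc hs ((mem_basesOf.1 hB).1.trans hG) (hG hxG) (indep_of_mem_basesOf hB)
      (mem_closure_of_mem_basesOf hG hrG hB hxG) hxB (Finset.card_pos.1 (by rw [(mem_basesOf.1 hB).2.2]; norm_num))
    refine le_trans ?_ (single_share_six_of_ge_four hs hG hrG hB hxG hxB (by omega))
    have := hdem₁ x hx
    rw [div_le_div_iff_of_pos_right (by norm_num)]
    linarith
  · intro P hP
    obtain ⟨hPsub, hPc⟩ := Finset.mem_powersetCard.1 hP
    obtain ⟨x, y, hxy, hPxy⟩ := Finset.card_eq_two.1 hPc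
    have hxP : x ∈ P := by rw [hPxy]; exact Finset.mem_insert_self x {y}
    have hyP : y ∈ P := by rw [hPxy]; exact Finset.mem_insert_of_mem (Finset.mem_singleton_self y)
    have hxG : x ∈ G := (Finset.mem_sdiff.1 (hPsub hxP)).1
    have hxB : x ∉ B₀ := (Finset.mem_sdiff.1 (hPsub hxP)).2
    have hyG : y ∈ G := (Finset.mem_sdiff.1 (hPsub hyP)).1
    have hyB : y ∉ B₀ := (Finset.mem_sdiff.1 (hPsub hyP)).2
    have hsh := pair_share_six_ge hs hline hG hrG hB hyG hyB hxG hxB hxy.symm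
    have hd := hdem₂ P hP
    rw [hPxy, SixFour.union_pair_eq] at hd ⊢
    refine le_trans ?_ hsh
    linarith

/-! ## The `t = 2` window of `(8, 6)` -/

/-- **The type-`2` balance on every rank-`6` flat with at most `12` points when lines have `≤ 3` points.** -/
theorem jq_two_nonneg_of_lines_six (hs : Simple M) (hline : ∀ L ∈ flatsQ M 2, L.card ≤ 3) {G : Finset α}
    (hG : G ∈ flatsQ M 6) (hcard : G.card ≤ 12) : 0 ≤ Jq M G 6 2 := by
  have hGg : G ⊆ gr M := (mem_flatsQ.1 hG).1
  have hrG : M.eRk (G : Set α) = ((6 : ℕ) : ℕ∞) := (mem_flatsQ.1 hG).2.2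
  apply Jq_two_nonneg_of_charge
  intro B₀ hB
  obtain ⟨hBG, hr, hc⟩ := mem_basesOf.1 hB
  have hkc : (G \ B₀).card = G.card - 6 := by rw [Finset.card_sdiff_of_subset hBG, hc]
  have hw : -(2 / 7 : ℚ) ≤ wTwo M G B₀ 6 := by
    unfold wTwo wInf
    have hm : mTr M B₀ ≤ 6 := mTr_le_of_eRk_eq (hBG.trans hGg) hr
    have hm' : (mTr M B₀ : ℚ) ≤ 6 := by exact_mod_cast hm
    have hwinf : (1 : ℚ) / 7 ≤ 1 / (1 + (mTr M B₀ : ℚ)) := one_div_le_one_div_of_le (by positivity) (by linarith)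
    have hd := dem_le_one (M := M) G B₀ 2
    push_cast
    nlinarith
  by_cases hk : (G \ B₀).card ≤ 1
  · have hd0 : dem M G 2 B₀ = 0 := dem_two_eq_zero_of_card_le_one hk
    have hw0 : 0 ≤ wTwo M G B₀ 6 := by
      unfold wTwo
      rw [hd0]
      have := wInf_pos (M := M) B₀
      push_cast
      nlinarith
    have hch : 0 ≤ charge M G 6 B₀ := by
      have := charge_ge_sum_of_subset (q := 6) hs hGg (by norm_num) B₀ (T := ∅) (Finset.empty_subset _)
      rwa [Finset.sum_empty] at this
    linarith
  · have hch := eightSix_charge_ge hs hline hGg hrG hB (by omega) (by omega)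
    linarith

/-- **THE `t = 2` WINDOW OF THE `(8, 6)` ROW ON THE CORE**: on every Core matroid, every rank-`6` flat with at most
`12` points satisfies the type-`2` balance `0 ≤ Jq M G 6 2`. -/
theorem jq_two_nonneg_of_core_six {γ : Type} [DecidableEq γ] {M : Matroid γ} [M.Finite] {p : ℕ} (hc : Core M p)
    {G : Finset γ} (hG : G ∈ flatsQ M 6) (hcard : G.card ≤ 12) : 0 ≤ Jq M G 6 2 :=
  jq_two_nonneg_of_lines_six (simple_of_core hc) (fun _ hL => card_le_three_of_line_of_core hc hL) hG hcard

/-- **The residue of the row `(8, 6)` at level `6`**: on every rank-`6` flat of a rank-`8` Core matroid, the type-`1`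
balance when `8 ≤ #G ≤ 9` and the type-`3`, `4`, `5` balances — `OpenLayersCore 6` without its type-`2` clause. -/
def EightSixResidueCore : Prop :=
  ∀ {β : Type} [DecidableEq β] (M : Matroid β) [M.Finite] (G : Finset β), Core M 8 → G ∈ flatsQ M 6 →
    (8 ≤ G.card → G.card ≤ 9 → 0 ≤ Jq M G 6 1) ∧ (∀ t, 3 ≤ t → t ≤ 5 → 0 ≤ Jq M G 6 t)

/-- **`OpenLayersCore 6` from the residue**: the type-`2` window `(g − 6)(g − 3) < 60`, i.e. `g ≤ 12`, is the kernel
theorem `jq_two_nonneg_of_core_six`; the type-`1` window `(g − 6)·9 + 1 < 36` is `g ≤ 9`. -/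
theorem openLayersCore_six_of_residue (h : EightSixResidueCore) : OpenLayersCore 6 := by
  intro β _ M _ G hc hG _
  obtain ⟨h1, h3⟩ := h M G hc hG
  refine ⟨fun _ h8 hwin => h1 h8 (by omega), fun hwin => ?_, fun t ht3 ht => h3 t ht3 (by omega)⟩
  apply jq_two_nonneg_of_core_six hc hG
  by_contra hg
  push Not at hg
  have h7 : 7 ≤ G.card - 6 := by omega
  have h10 : 10 ≤ G.card - 6 + 3 := by omega
  have := Nat.mul_le_mul h7 h10
  omega

/-- **C-025 at `(8, 6)` on every finite matroid from `OpenLayersCore 5` and the `(8, 6)` residue.** -/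
theorem rls_eight_six_of_residue {α : Type} [DecidableEq α] (h5 : OpenLayersCore 5) (h6 : EightSixResidueCore)
    (M : Matroid α) [M.Finite] : RLS M 8 6 := by
  refine rls_succ_succ_of_openLayersCore 6 (by norm_num) ?_ M
  intro q' hq'5 hq'
  rcases (show q' = 5 ∨ q' = 6 by omega) with rfl | rfl
  · exact h5
  · exact openLayersCore_six_of_residue h6

end PercRepro.GenQ
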